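import Summits.ValiantsHypothesis.ValiantsHypothesis.Theses.SymmetroidDescartes
import Summits.ValiantsHypothesis.ValiantsHypothesis.Theorems.DerivedPencilRolle.Negative.DerivedPencilRolleUniformStep
import Summits.ValiantsHypothesis.ValiantsHypothesis.Theorems.SymmetroidDescartesRolleToDescartes

/-!
# `DerivedPencilRolle` — negative lemma: the Rolle term can vanish identically (indefinite `2 × 2` witness)

Crux `stmt-ValiantsHypothesis-18500` (`Theses.SymmetroidDescartes.DerivedPencilRolle`):
`∃ C a, ∀ m K S d, …, Z₊(det F) ≤ C · Z₊(det ∂F) + (m+K)^a`.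

The witness (cdisprove seat, 2026-08-17): `m = 2`, `K = 3`, `d = (0,1,2,3)`,
`F(t) = [[2000 + s(t), 1000·Q(t)], [1000·Q(t), 2000 − s(t)]]`, `s = t + t² + t³`,
`Q = 2t³ − 12t² + 16t − 3`.  The diagonal moves MONOTONICALLY in opposite directions, so the derived
pencil `∂F(t) = F'(t) = [[s', 1000 Q'], [1000 Q', −s']]` has `det ∂F = −s'² − 10⁶ Q'² < 0` for every real
`t` (`s' = 1 + 2t + 3t² > 0`): **`Z₊(det ∂F) = 0`, whatever `C` is**; while
`det F = 4·10⁶ − s² − 10⁶ Q²` changes sign at `1/20 < 1/4 < 1 < 3/2 < 3 < 21/5 < 5` (the cubic `Q` crosses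
each of the levels `±2` three times), so `Z₊(det F) ≥ 6 > (2+3)^a` for `a ≤ 1`.

Consequences (all sorry-free):
* `not_pencilBound_two_of_le_one : a ≤ 1 → ¬ PencilBound C a 2` for EVERY `C` — the additive exponent of
  the crux is `≥ 2` independently of the multiplier (the tree's `not_instance_of_small_constants` needed
  `2C + 6^a < 9`);
* `not_derivedPencilRolle_linear : ¬ ∃ C a, a ≤ 1 ∧ ∀ m, PencilBound C a m` — the natural strengthening
  "linear additive slack" of the crux is false;
* the mechanism: on the class of pencils whose derived pencil is nonsingular on `(0,∞)` the crux degenerates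
  to an ABSOLUTE polynomial bound `Z₊(det F) ≤ (m+K)^a` (see `Cruxes/DerivedPencilRolle/Disproof.lean`, where
  this class is shown to contain every ABP over lacunary monomials up to a harmless perturbation).

[folklore] Elementary; the sign pattern is certified by `norm_num` at rational points.
-/

-- `Summit.ValiantsHypothesis.ValiantsHypothesis.…` repeats a component by the D-0017 layout
-- (single-conjunct summit), which the `dupNamespace` linter flags; the name is mandated.
set_option linter.dupNamespace false

namespace Summit.ValiantsHypothesis.ValiantsHypothesis.Theorems.DerivedPencilRolle.Negative

open Summit.ValiantsHypothesis.ValiantsHypothesis.Theses.SymmetroidDescartes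
open Summit.ValiantsHypothesis.ValiantsHypothesis.Theorems.SymmetroidDescartes (eval_det_pencil
  le_card_posRoots_of_alternating)
open scoped BigOperators Matrix
open Polynomial

/-- The indefinite `2 × 2` four-nomial witness: `S₅ 0 = [[2000,-3000],[-3000,2000]]`,
`S₅ 1 = [[1,16000],[16000,-1]]`, `S₅ 2 = [[1,-12000],[-12000,-1]]`, `S₅ 3 = [[1,2000],[2000,-1]]`. -/
def S₅ : Fin 4 → Matrix (Fin 2) (Fin 2) ℝ :=
  ![!![2000, -3000; -3000, 2000], !![1, 16000; 16000, -1], !![1, -12000; -12000, -1],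
    !![1, 2000; 2000, -1]]

/-- exponents `d l = l` -/
def d₅ : Fin 4 → ℕ := fun l => (l : ℕ)

/-- `d₅` is strictly increasing. -/
theorem d₅_strictMono : StrictMono d₅ := fun a b h => by
  simpa [d₅] using h

/-- every coefficient of the witness is symmetric -/
theorem S₅_symm (l : Fin 4) : (S₅ l).IsSymm := by
  fin_cases l <;> (unfold Matrix.IsSymm; ext i j; fin_cases i <;> fin_cases j <;> rfl)

/-- every coefficient of the witness is invertible -/
theorem S₅_det (l : Fin 4) : (S₅ l).det ≠ 0 := by
  fin_cases l <;> simp [S₅, Matrix.det_fin_two] <;> norm_num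

/-- `det F(t)` in closed form. -/
theorem eval_det_F₅ (t : ℝ) :
    ((∑ l, (X : ℝ[X]) ^ d₅ l • (S₅ l).map Polynomial.C).det).eval t =
      (2000 + (t + t ^ 2 + t ^ 3)) * (2000 - (t + t ^ 2 + t ^ 3)) -
        (1000 * (2 * t ^ 3 - 12 * t ^ 2 + 16 * t - 3)) ^ 2 := by
  rw [eval_det_pencil]
  simp [Matrix.det_fin_two, Fin.sum_univ_four, S₅, d₅]
  ring

/-- `det ∂F(t)` in closed form (it is negative for every real `t`). -/
theorem eval_det_dF₅ (t : ℝ) :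
    ((∑ l : Fin 3, (X : ℝ[X]) ^ (d₅ l.succ - d₅ 0 - 1) •
        (((d₅ l.succ - d₅ 0 : ℕ) : ℝ) • S₅ l.succ).map Polynomial.C).det).eval t =
      -(1 + 2 * t + 3 * t ^ 2) ^ 2 - (16000 - 24000 * t + 6000 * t ^ 2) ^ 2 := by
  rw [eval_det_pencil (fun l : Fin 3 => ((d₅ l.succ - d₅ 0 : ℕ) : ℝ) • S₅ l.succ)
    (fun l => d₅ l.succ - d₅ 0 - 1) t]
  simp [Matrix.det_fin_two, Fin.sum_univ_three, S₅, d₅, Fin.succ]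
  ring

/-- `det ∂F(t) < 0` for every real `t`. -/
theorem eval_det_dF₅_neg (t : ℝ) :
    ((∑ l : Fin 3, (X : ℝ[X]) ^ (d₅ l.succ - d₅ 0 - 1) •
        (((d₅ l.succ - d₅ 0 : ℕ) : ℝ) • S₅ l.succ).map Polynomial.C).det).eval t < 0 := by
  rw [eval_det_dF₅]
  have h1 : 0 < 1 + 2 * t + 3 * t ^ 2 := by nlinarith [sq_nonneg (t + 1/3)]
  nlinarith [sq_nonneg (16000 - 24000 * t + 6000 * t ^ 2), mul_pos h1 h1]

/-- The derived determinant has no positive roots (indeed no real roots). -/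
theorem card_posRoots_dF₅ :
    ((∑ l : Fin 3, (X : ℝ[X]) ^ (d₅ l.succ - d₅ 0 - 1) •
        (((d₅ l.succ - d₅ 0 : ℕ) : ℝ) • S₅ l.succ).map Polynomial.C).det.roots.toFinset.filter
          (fun t => 0 < t)).card = 0 := by
  rw [Finset.card_eq_zero, Finset.filter_eq_empty_iff]
  intro t ht
  rw [Multiset.mem_toFinset] at ht
  have h := (mem_roots'.1 ht).2
  have hneg := eval_det_dF₅_neg t
  rw [IsRoot.def] at h
  exact absurd h (ne_of_lt hneg)

/-- seven positive test points with alternating signs of `det F` -/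
noncomputable def τ₅ : Fin 7 → ℝ := ![1/20, 1/4, 1, 3/2, 3, 21/5, 5]

/-- the test points increase -/
theorem τ₅_strictMono : StrictMono τ₅ := by
  refine Fin.strictMono_iff_lt_succ.2 fun j => ?_
  fin_cases j <;> simp [τ₅] <;> norm_num

/-- the test points are positive -/
theorem τ₅_pos (j : Fin 7) : 0 < τ₅ j := by
  fin_cases j <;> simp [τ₅]

/-- `det F` alternates in sign along the test points (`norm_num` certificate). -/
theorem alt₅ (j : Fin 6) :
    ((∑ l, (X : ℝ[X]) ^ d₅ l • (S₅ l).map Polynomial.C).det).eval (τ₅ j.castSucc) *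
      ((∑ l, (X : ℝ[X]) ^ d₅ l • (S₅ l).map Polynomial.C).det).eval (τ₅ j.succ) < 0 := by
  fin_cases j <;> simp only [eval_det_F₅, τ₅] <;> simp <;> norm_num

/-- `det F` has at least six distinct positive roots. -/
theorem six_le_card_posRoots_F₅ :
    6 ≤ ((∑ l, (X : ℝ[X]) ^ d₅ l • (S₅ l).map Polynomial.C).det.roots.toFinset.filter
      (fun t => 0 < t)).card :=
  le_card_posRoots_of_alternating _ 6 τ₅ τ₅_strictMono τ₅_pos alt₅

/-- **The additive exponent is at least two, for every multiplier.** `m = 2`, `K = 3`: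
`Z₊(det F) ≥ 6` while `Z₊(det ∂F) = 0`, so `6 ≤ C·0 + 5^a` fails for `a ≤ 1`. -/
theorem not_pencilBound_two_of_le_one (C a : ℕ) (ha : a ≤ 1) : ¬ PencilBound C a 2 := by
  intro h
  have h1 := h 3 S₅ d₅ S₅_symm S₅_det d₅_strictMono
  rw [card_posRoots_dF₅] at h1
  have h6 : 6 ≤ C * 0 + (2 + 3) ^ a := six_le_card_posRoots_F₅.trans h1
  have h5 : (2 + 3) ^ a ≤ 5 := by
    interval_cases a <;> norm_num
  omega

/-- The natural strengthening "linear additive slack" of the crux is false. -/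
theorem not_derivedPencilRolle_linear : ¬ ∃ C a : ℕ, a ≤ 1 ∧ ∀ m, PencilBound C a m :=
  fun ⟨C, a, ha, h⟩ => not_pencilBound_two_of_le_one C a ha (h 2)

/-- Any constants witnessing the crux have additive exponent `a ≥ 2`. -/
theorem two_le_of_pencilBound (C a : ℕ) (h : ∀ m, PencilBound C a m) : 2 ≤ a := by
  by_contra hlt
  exact not_pencilBound_two_of_le_one C a (by omega) (h 2)

end Summit.ValiantsHypothesis.ValiantsHypothesis.Theorems.DerivedPencilRolle.Negative
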